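import Summits.HodgeConjecture.HodgeCM.Model.ToyG2.ThetaUiso_1

/-! PORT of `HodgeCM/Model/ToyG2/ThetaUiso.lean` (HodgeCMPerL run 82) — part 2: continuation of `Summits.HodgeConjecture.HodgeCM.Model.ToyG2.ThetaUiso_1` (split at a top-level declaration boundary by port_pkg.py; scope re-opened below; declarations unchanged). -/

-- port_pkg: scope re-opened for this part (file-level context, then the namespace/section stack open at the cut)
namespace HodgeCM.ToyG2.ThetaUiso
open HodgeCM.Toy HodgeCM.Toy.CMPresentation HodgeCM.ToyG2 HodgeCM.ToyG2.Obj₂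
open HodgeCM.ToyG2.InputsWitness (extC extC_tmul extC_eq_baseChange extC_eps_eigen extC_injective jT
  ιMulti_two_ne_zero)
open Literature.AlgebraicGeometry.Motives
open scoped TensorProduct
open exteriorPower
noncomputable section
section Leaf
variable {L : CMField} (ι₁ : L →+* ℂ) (d t : ℚ)
variable (k : Fin (nQ L ι₁))
variable (i : Fin 4)
variable {K : CMField} (j : K →+* L) (Ψ : CMType K)
/-- **dual-basis inversion for single eigenvectors** (universe-free): for `τ₀` over `σ` (`τ₀ ∘ j = σ`),
`E_{k,i,τ₀} = Σ_n τ₀(d_n) • (⋀¹ m_{k,i,b_n})_ℂ (gen_σ)` -/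
theorem eCls_eq_sum_map_leafLin_gen (σ : K →+* ℂ) {τ₀ : FK L →+* ℂ} (hτ₀ : τ₀.comp (jT j) = embOf K σ) :
    eCls ι₁ d t k i τ₀
      = ∑ n, τ₀ (dF (FK L) n) • (map 1 (leafLin ι₁ d t k i j Ψ (bF (FK L) n))).baseChange ℂ (gen K Ψ σ) :=
  calc eCls ι₁ d t k i τ₀ = slotC ι₁ d t k i (eps (FK L) τ₀) := rfl
    _ = slotC ι₁ d t k i (∑ n, τ₀ (dF (FK L) n) • ((1 ⊗ₜ[ℚ] bF (FK L) n) * extC (jT j)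
          (eps (FK K) (embOf K σ)))) := by rw [sum_dF_smul_bF_mul_extC_eps (jT j) hτ₀]
    _ = ∑ n, τ₀ (dF (FK L) n) • slotC ι₁ d t k i ((1 ⊗ₜ[ℚ] bF (FK L) n) * extC (jT j)
          (eps (FK K) (embOf K σ))) := by simp only [map_sum, map_smul]
    _ = _ := Finset.sum_congr rfl fun n _ =>
          congrArg (τ₀ (dF (FK L) n) • ·) (map_leafLin_gen_eq_slotC ι₁ d t k i j Ψ σ (bF (FK L) n)).symm

/-- the generator of the `σ`-eigenline is a holomorphic `σ`-eigenform for `σ ∈ Ψ` (generation-1 statement; the toy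
universes on the period leaves have the same `alphaLine` by `rfl`) -/
lemma gen_mem_alphaLine₁ {σ : K →+* ℂ} (hσ : σ ∈ Ψ.1) :
    gen K Ψ σ ∈ (toyModelWith exteriorHodgeData).alphaLine K Ψ σ := by
  rw [alphaLine_eq]
  exact ⟨gen_mem_F1C K Ψ hσ, gen_mem_eigenLine exteriorHodgeData K Ψ σ⟩

end Leaf

/-! ### Wedges of single eigenvectors -/

section Wedge

variable {L : CMField} (ι₁ : L →+* ℂ) (d t : ℚ)

/-- (Ported verbatim from the HodgeCMPerL package; no docstring in the source.) -/
lemma pr_baseChange_emb_self (Θ : Fin 4 → CMType L) (i : Fin 4) (y : ℂ ⊗[ℚ] FK L) :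
    (pr L Θ i).baseChange ℂ ((emb L Θ i).baseChange ℂ y) = y := by
  have hc : pr L Θ i ∘ₗ emb L Θ i = LinearMap.id := LinearMap.ext fun u => pr_emb_self L Θ i u
  rw [← LinearMap.comp_apply, ← LinearMap.baseChange_comp, hc, LinearMap.baseChange_id, LinearMap.id_apply]

/-- (Ported verbatim from the HodgeCMPerL package; no docstring in the source.) -/
lemma pr_baseChange_emb_of_ne (Θ : Fin 4 → CMType L) {i i' : Fin 4} (h : i ≠ i') (y : ℂ ⊗[ℚ] FK L) :
    (pr L Θ i').baseChange ℂ ((emb L Θ i).baseChange ℂ y) = 0 := by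
  have hc : pr L Θ i' ∘ₗ emb L Θ i = 0 := LinearMap.ext fun u => pr_emb_of_ne L Θ h u
  rw [← LinearMap.comp_apply, ← LinearMap.baseChange_comp, hc, LinearMap.baseChange_zero,
    LinearMap.zero_apply]

/-- the coordinate functional `⟨(k, i, τ'), –⟩` on `ℂ ⊗ L(P(L, ι₁))`: block `k`, slot `i`, character `τ'` -/
def coordAt (k : Fin (nQ L ι₁)) (i : Fin 4) (τ' : FK L →+* ℂ) : Module.Dual ℂ (PO ι₁ d t).LC :=
  (epsBasis (F := FK L)).coord τ' ∘ₗ (pr L (ΘOf L ι₁ k) i).baseChange ℂ ∘ₗ (leafProj ι₁ d t k).baseChange ℂ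

/-- (Ported verbatim from the HodgeCMPerL package; no docstring in the source.) -/
lemma coordAt_apply (k : Fin (nQ L ι₁)) (i : Fin 4) (τ' : FK L →+* ℂ) (v : (PO ι₁ d t).LC) :
    coordAt ι₁ d t k i τ' v
      = (epsBasis (F := FK L)).repr ((pr L (ΘOf L ι₁ k) i).baseChange ℂ ((leafProj ι₁ d t k).baseChange ℂ v)) τ' :=
  rfl

/-- (Ported verbatim from the HodgeCMPerL package; no docstring in the source.) -/
lemma coordAt_eVec_self (k : Fin (nQ L ι₁)) (i : Fin 4) (τ' : FK L →+* ℂ) :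
    coordAt ι₁ d t k i τ' (eVec ι₁ d t k i τ') = 1 := by
  rw [coordAt_apply, eVec, leafProj_baseChange_leafIncl_self, pr_baseChange_emb_self, ← epsBasis_apply,
    Module.Basis.repr_self, Finsupp.single_eq_same]

/-- (Ported verbatim from the HodgeCMPerL package; no docstring in the source.) -/
lemma coordAt_eVec_of_ne {k k' : Fin (nQ L ι₁)} {i i' : Fin 4} {τ τ' : FK L →+* ℂ}
    (h : k ≠ k' ∨ i ≠ i' ∨ τ ≠ τ') : coordAt ι₁ d t k' i' τ' (eVec ι₁ d t k i τ) = 0 := by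
  rw [coordAt_apply, eVec]
  by_cases hk : k' = k
  · subst hk
    rw [leafProj_baseChange_leafIncl_self]
    by_cases hi : i = i'
    · subst hi
      rw [pr_baseChange_emb_self, ← epsBasis_apply, Module.Basis.repr_self]
      rcases h with h | h | h
      · exact absurd rfl h
      · exact absurd rfl h
      · exact Finsupp.single_eq_of_ne h.symm
    · rw [pr_baseChange_emb_of_ne _ hi, map_zero, Finsupp.zero_apply]
  · rw [leafProj_baseChange_leafIncl_of_ne ι₁ d t hk, map_zero, map_zero, Finsupp.zero_apply]

/-- two DISTINCT single eigenvectors have nonzero wedge in `⋀²_ℂ (ℂ ⊗ L(P(L, ι₁)))` -/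
theorem ιMulti_eVec_ne_zero {k k' : Fin (nQ L ι₁)} {i i' : Fin 4} {τ τ' : FK L →+* ℂ}
    (h : k ≠ k' ∨ i ≠ i' ∨ τ ≠ τ') :
    ιMulti ℂ 2 ![eVec ι₁ d t k i τ, eVec ι₁ d t k' i' τ'] ≠ 0 :=
  ιMulti_two_ne_zero _ _ (coordAt ι₁ d t k i τ) (coordAt ι₁ d t k' i' τ')
    (by rw [coordAt_eVec_self]; exact one_ne_zero)
    (by rw [coordAt_eVec_self]; exact one_ne_zero)
    (coordAt_eVec_of_ne ι₁ d t h)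

/-- **the wedge of two distinct single-eigenvector classes is nonzero**, core form (universe-free): in
`ℂ ⊗ ⋀² L(P(L, ι₁))`; for each toy universe on the period leaves this is `U.cup2C (pms) 1 E E' ≠ 0` by `rfl` -/
theorem wedge_eCls_ne_zero {k k' : Fin (nQ L ι₁)} {i i' : Fin 4} {τ τ' : FK L →+* ℂ}
    (h : k ≠ k' ∨ i ≠ i' ∨ τ ≠ τ') :
    LinearMap.BilinMap.baseChange ℂ (wedge ℚ (PO ι₁ d t).L 1 1) (eCls ι₁ d t k i τ) (eCls ι₁ d t k' i' τ')
      ≠ 0 := by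
  intro h0
  apply ιMulti_eVec_ne_zero ι₁ d t h
  rw [← theta_pair (PO ι₁ d t), ← eCls_eq_form1, ← eCls_eq_form1, h0]
  exact map_zero _

end Wedge

/-! ### 5₂. The universe `toyUniverse₂ d t`: isotypy, wedge, theta sets, the two `H¹`-inputs (the universe of
`ToyG2.PeriodLeaf` / `InputsWitness`; M26 fails on it by `ToyG2.NoGysin`; kept for comparison with `InputsWitness`) -/

section U₂

variable (d t : ℚ) {K L : CMField} (ι₁ : L →+* ℂ) (k : Fin (nQ L ι₁)) (i : Fin 4) (j : K →+* L) (Ψ : CMType K)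
  {V : HermSpace3 L ι₁} (Γ : Level V)

/-- the morphisms `pms → A_{(K,Ψ)}` of `toyUniverse₂ d t` are the `Hom₂ (pbObj P(L, ι₁)) (cmObj₂ K Ψ)` (`rfl`) -/
example : (toyUniverse₂ d t).Mor ((toyUniverse₂ d t).pms L ι₁ V Γ) ((toyUniverse₂ d t).cmAV K Ψ)
    = Hom₂ (pbObj (pLeafOf L ι₁ d t)) (cmObj₂ K Ψ) := rfl

open scoped Classical in
/-- **the pull-back formula** in `toyUniverse₂ d t`: `m_{k,i,x}^*(gen_σ) = Σ_{τ' ∘ j = σ} τ'(x) • E_{k,i,τ'}` -/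
theorem pullC_leafMor_gen₂ (σ : K →+* ℂ) (x : FK L) (hΘ : ΘOf L ι₁ k i = indType j Ψ) :
    (toyUniverse₂ d t).pullC (X := (toyUniverse₂ d t).pms L ι₁ V Γ) (Y := (toyUniverse₂ d t).cmAV K Ψ)
        (leafMor ι₁ d t k i j Ψ x hΘ) 1 (gen K Ψ σ)
      = ∑ τ' ∈ Finset.univ.filter (fun τ' : FK L →+* ℂ => τ'.comp (jT j) = embOf K σ),
          τ' x • eCls ι₁ d t k i τ' :=
  map_leafLin_gen ι₁ d t k i j Ψ σ x

/-- the generator of the `σ`-eigenline is a holomorphic `σ`-eigenform of `toyUniverse₂ d t` for `σ ∈ Ψ` -/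
lemma gen_mem_alphaLine₂ {σ : K →+* ℂ} (hσ : σ ∈ Ψ.1) : gen K Ψ σ ∈ (toyUniverse₂ d t).alphaLine K Ψ σ :=
  gen_mem_alphaLine₁ Ψ hσ

/-- each pull-back `m_{k,i,x}^*(gen_σ)`, `σ ∈ Ψ`, is an isotypic class (a generator of `U_iso`) -/
lemma pullC_leafMor_gen_mem_uiso₂ {σ : K →+* ℂ} (hσ : σ ∈ Ψ.1) (x : FK L)
    (hΘ : ΘOf L ι₁ k i = indType j Ψ) :
    (toyUniverse₂ d t).pullC (X := (toyUniverse₂ d t).pms L ι₁ V Γ) (Y := (toyUniverse₂ d t).cmAV K Ψ)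
        (leafMor ι₁ d t k i j Ψ x hΘ) 1 (gen K Ψ σ) ∈ (toyUniverse₂ d t).Uiso Γ K Ψ σ :=
  Submodule.subset_span ⟨leafMor ι₁ d t k i j Ψ x hΘ, gen K Ψ σ, gen_mem_alphaLine₂ d t Ψ hσ, rfl⟩

/-- **single eigenvectors are isotypic** in `toyUniverse₂ d t`: for `σ ∈ Ψ`, slot `(k, i)` of induced type and ANY
`τ₀` over `σ`, `E_{k,i,τ₀} ∈ U_iso(Γ; K, Ψ, σ)` -/
theorem eCls_mem_uiso₂ {σ : K →+* ℂ} (hσ : σ ∈ Ψ.1) (hΘ : ΘOf L ι₁ k i = indType j Ψ)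
    {τ₀ : FK L →+* ℂ} (hτ₀ : τ₀.comp (jT j) = embOf K σ) :
    eCls ι₁ d t k i τ₀ ∈ (toyUniverse₂ d t).Uiso Γ K Ψ σ := by
  rw [eCls_eq_sum_map_leafLin_gen ι₁ d t k i j Ψ σ hτ₀]
  exact Submodule.sum_mem _ fun n _ =>
    Submodule.smul_mem _ _ (pullC_leafMor_gen_mem_uiso₂ d t ι₁ k i j Ψ Γ hσ (bF (FK L) n) hΘ)

/-- **the cup product of two distinct single-eigenvector classes is nonzero** in `H²(pms, ℂ)` of `toyUniverse₂ d t` -/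
theorem cup_eCls_ne_zero₂ {k k' : Fin (nQ L ι₁)} {i i' : Fin 4} {τ τ' : FK L →+* ℂ}
    (h : k ≠ k' ∨ i ≠ i' ∨ τ ≠ τ') :
    (toyUniverse₂ d t).cup2C ((toyUniverse₂ d t).pms L ι₁ V Γ) 1 (eCls ι₁ d t k i τ) (eCls ι₁ d t k' i' τ') ≠ 0 :=
  wedge_eCls_ne_zero ι₁ d t h

/-- **the candidate theta sets** of `toyUniverse₂ d t` at a context `c = (K, Ψ, σ, D)`: the single eigenvectors
`E_{qInd(j), i, ι₁}` — character `ι₁` (transported to `FK L`), slot `i` of the block of the quadruple induced along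
`j` — over the embeddings `j : K →+* L` with `ι₁ ∘ j = σ` (and the side conditions making the induced quadruple
an index of the leaf; in a good context they hold: `GoodCtx.pairSum`, `GoodCtx.mem`, `GoodCtx.forced`) -/
def thetaSet₂ (V : HermSpace3 L ι₁) (c : SeesawCtx L) (i : Fin 4) (Γ : Level V) :
    Set ((toyUniverse₂ d t).CohC ((toyUniverse₂ d t).pms L ι₁ V Γ) 1) :=
  {ω | ∃ (j : c.K →+* L) (hP : PairSum c.Ψ) (hm : ∀ i, ι₁.comp j ∈ (c.Ψ i).1),
    ι₁.comp j = c.σ ∧ ω = eCls ι₁ d t (eQ L ι₁ (qInd ι₁ j c.Ψ hP hm)) i (embOf L ι₁)}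

/-- **theta classes are isotypic** (`Open_thetaSub` for these theta sets; no hypothesis on the context) -/
theorem thetaSet_sub_uiso₂ (V : HermSpace3 L ι₁) (c : SeesawCtx L) (i : Fin 4) (Γ : Level V) :
    thetaSet₂ d t ι₁ V c i Γ ⊆ (toyUniverse₂ d t).Uiso Γ c.K (c.Ψ i) c.σ := by
  rintro ω ⟨j, hP, hm, hj, rfl⟩
  rw [← hj]
  exact eCls_mem_uiso₂ d t ι₁ _ i j (c.Ψ i) Γ (hm i) (ΘOf_eQ_qInd ι₁ j c.Ψ hP hm i)
    (embOf_comp_jT ι₁ j)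

/-- **the wedge of theta classes of types `Ψ₀, Ψ₁` is nonzero** (`Open_thetaWedge` for these theta sets), as soon
as the context admits `j` with `ι₁ ∘ j = σ`, `Ψ` is pair-sum and `σ` lies in all four types -/
theorem thetaSet_wedge₂ (V : HermSpace3 L ι₁) (c : SeesawCtx L) (j : c.K →+* L) (hj : ι₁.comp j = c.σ)
    (hP : PairSum c.Ψ) (hmem : ∀ i, c.σ ∈ (c.Ψ i).1) :
    ∃ Γ : Level V, ∃ ω₁ ∈ thetaSet₂ d t ι₁ V c 0 Γ, ∃ ω₂ ∈ thetaSet₂ d t ι₁ V c 1 Γ,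
      (toyUniverse₂ d t).cup2C ((toyUniverse₂ d t).pms L ι₁ V Γ) 1 ω₁ ω₂ ≠ 0 := by
  have hm : ∀ i, ι₁.comp j ∈ (c.Ψ i).1 := fun i => hj ▸ hmem i
  obtain ⟨Γ⟩ := Level.nonempty V
  exact ⟨Γ, _, ⟨j, hP, hm, hj, rfl⟩, _, ⟨j, hP, hm, hj, rfl⟩,
    cup_eCls_ne_zero₂ d t ι₁ Γ (Or.inr (Or.inl Fin.zero_ne_one))⟩

/-- `Open_thetaSub` for ANY theta model on `toyUniverse₂ d t` whose theta sets are `thetaSet₂` -/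
theorem open_thetaSub_of_theta_eq₂ (T : (toyUniverse₂ d t).ThetaModel)
    (hT : ∀ {L : CMField} {ι₁ : L →+* ℂ} (V : HermSpace3 L ι₁) (c : SeesawCtx L) (i : Fin 4) (Γ : Level V),
      T.Theta V c i Γ = thetaSet₂ d t ι₁ V c i Γ) :
    T.Open_thetaSub := by
  intro L ι₁ V c _ i Γ
  rw [hT]
  exact thetaSet_sub_uiso₂ d t ι₁ V c i Γ

/-- `Open_thetaWedge` for ANY theta model on `toyUniverse₂ d t` whose theta sets are `thetaSet₂` -/
theorem open_thetaWedge_of_theta_eq₂ (T : (toyUniverse₂ d t).ThetaModel)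
    (hT : ∀ {L : CMField} {ι₁ : L →+* ℂ} (V : HermSpace3 L ι₁) (c : SeesawCtx L) (i : Fin 4) (Γ : Level V),
      T.Theta V c i Γ = thetaSet₂ d t ι₁ V c i Γ) :
    T.Open_thetaWedge := by
  intro L ι₁ V c hc
  obtain ⟨j, hj, -⟩ := hc.forced
  obtain ⟨Γ, ω₁, h₁, ω₂, h₂, hne⟩ := thetaSet_wedge₂ d t ι₁ V c j hj hc.pairSum hc.mem
  exact ⟨Γ, ω₁, (hT V c 0 Γ).symm ▸ h₁, ω₂, (hT V c 1 Γ).symm ▸ h₂, hne⟩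

end U₂

/-! ### 5₃. The universe `toyUniverse₃ d t`: isotypy, wedge, theta sets, the two `H¹`-inputs (the universe on GOOD
objects of `ToyG2.Universe3` — the live candidate model) -/

section U₃

variable (d t : ℚ) {K L : CMField} (ι₁ : L →+* ℂ) (k : Fin (nQ L ι₁)) (i : Fin 4) (j : K →+* L) (Ψ : CMType K)
  {V : HermSpace3 L ι₁} (Γ : Level V)

/-- the morphisms `pms → A_{(K,Ψ)}` of `toyUniverse₃ d t` are the `Hom₂ (pbObj P(L, ι₁)) (cmObj₂ K Ψ)` (`rfl`) -/
example : (toyUniverse₃ d t).Mor ((toyUniverse₃ d t).pms L ι₁ V Γ) ((toyUniverse₃ d t).cmAV K Ψ)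
    = Hom₂ (pbObj (pLeafOf L ι₁ d t)) (cmObj₂ K Ψ) := rfl

open scoped Classical in
/-- **the pull-back formula** in `toyUniverse₃ d t`: `m_{k,i,x}^*(gen_σ) = Σ_{τ' ∘ j = σ} τ'(x) • E_{k,i,τ'}` -/
theorem pullC_leafMor_gen₃ (σ : K →+* ℂ) (x : FK L) (hΘ : ΘOf L ι₁ k i = indType j Ψ) :
    (toyUniverse₃ d t).pullC (X := (toyUniverse₃ d t).pms L ι₁ V Γ) (Y := (toyUniverse₃ d t).cmAV K Ψ)
        (leafMor ι₁ d t k i j Ψ x hΘ) 1 (gen K Ψ σ)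
      = ∑ τ' ∈ Finset.univ.filter (fun τ' : FK L →+* ℂ => τ'.comp (jT j) = embOf K σ),
          τ' x • eCls ι₁ d t k i τ' :=
  map_leafLin_gen ι₁ d t k i j Ψ σ x

/-- the generator of the `σ`-eigenline is a holomorphic `σ`-eigenform of `toyUniverse₃ d t` for `σ ∈ Ψ` -/
lemma gen_mem_alphaLine₃ {σ : K →+* ℂ} (hσ : σ ∈ Ψ.1) : gen K Ψ σ ∈ (toyUniverse₃ d t).alphaLine K Ψ σ :=
  gen_mem_alphaLine₁ Ψ hσ

/-- each pull-back `m_{k,i,x}^*(gen_σ)`, `σ ∈ Ψ`, is an isotypic class (a generator of `U_iso`) -/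
lemma pullC_leafMor_gen_mem_uiso₃ {σ : K →+* ℂ} (hσ : σ ∈ Ψ.1) (x : FK L)
    (hΘ : ΘOf L ι₁ k i = indType j Ψ) :
    (toyUniverse₃ d t).pullC (X := (toyUniverse₃ d t).pms L ι₁ V Γ) (Y := (toyUniverse₃ d t).cmAV K Ψ)
        (leafMor ι₁ d t k i j Ψ x hΘ) 1 (gen K Ψ σ) ∈ (toyUniverse₃ d t).Uiso Γ K Ψ σ :=
  Submodule.subset_span ⟨leafMor ι₁ d t k i j Ψ x hΘ, gen K Ψ σ, gen_mem_alphaLine₃ d t Ψ hσ, rfl⟩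

/-- **single eigenvectors are isotypic** in `toyUniverse₃ d t`: for `σ ∈ Ψ`, slot `(k, i)` of induced type and ANY
`τ₀` over `σ`, `E_{k,i,τ₀} ∈ U_iso(Γ; K, Ψ, σ)` -/
theorem eCls_mem_uiso₃ {σ : K →+* ℂ} (hσ : σ ∈ Ψ.1) (hΘ : ΘOf L ι₁ k i = indType j Ψ)
    {τ₀ : FK L →+* ℂ} (hτ₀ : τ₀.comp (jT j) = embOf K σ) :
    eCls ι₁ d t k i τ₀ ∈ (toyUniverse₃ d t).Uiso Γ K Ψ σ := by
  rw [eCls_eq_sum_map_leafLin_gen ι₁ d t k i j Ψ σ hτ₀]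
  exact Submodule.sum_mem _ fun n _ =>
    Submodule.smul_mem _ _ (pullC_leafMor_gen_mem_uiso₃ d t ι₁ k i j Ψ Γ hσ (bF (FK L) n) hΘ)

/-- **the cup product of two distinct single-eigenvector classes is nonzero** in `H²(pms, ℂ)` of `toyUniverse₃ d t` -/
theorem cup_eCls_ne_zero₃ {k k' : Fin (nQ L ι₁)} {i i' : Fin 4} {τ τ' : FK L →+* ℂ}
    (h : k ≠ k' ∨ i ≠ i' ∨ τ ≠ τ') :
    (toyUniverse₃ d t).cup2C ((toyUniverse₃ d t).pms L ι₁ V Γ) 1 (eCls ι₁ d t k i τ) (eCls ι₁ d t k' i' τ') ≠ 0 :=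
  wedge_eCls_ne_zero ι₁ d t h

/-- **the candidate theta sets** of `toyUniverse₃ d t` at a context `c = (K, Ψ, σ, D)`: the single eigenvectors
`E_{qInd(j), i, ι₁}` — character `ι₁` (transported to `FK L`), slot `i` of the block of the quadruple induced along
`j` — over the embeddings `j : K →+* L` with `ι₁ ∘ j = σ` (and the side conditions making the induced quadruple
an index of the leaf; in a good context they hold: `GoodCtx.pairSum`, `GoodCtx.mem`, `GoodCtx.forced`) -/
def thetaSet₃ (V : HermSpace3 L ι₁) (c : SeesawCtx L) (i : Fin 4) (Γ : Level V) :
    Set ((toyUniverse₃ d t).CohC ((toyUniverse₃ d t).pms L ι₁ V Γ) 1) :=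
  {ω | ∃ (j : c.K →+* L) (hP : PairSum c.Ψ) (hm : ∀ i, ι₁.comp j ∈ (c.Ψ i).1),
    ι₁.comp j = c.σ ∧ ω = eCls ι₁ d t (eQ L ι₁ (qInd ι₁ j c.Ψ hP hm)) i (embOf L ι₁)}

/-- **theta classes are isotypic** (`Open_thetaSub` for these theta sets; no hypothesis on the context) -/
theorem thetaSet_sub_uiso₃ (V : HermSpace3 L ι₁) (c : SeesawCtx L) (i : Fin 4) (Γ : Level V) :
    thetaSet₃ d t ι₁ V c i Γ ⊆ (toyUniverse₃ d t).Uiso Γ c.K (c.Ψ i) c.σ := by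
  rintro ω ⟨j, hP, hm, hj, rfl⟩
  rw [← hj]
  exact eCls_mem_uiso₃ d t ι₁ _ i j (c.Ψ i) Γ (hm i) (ΘOf_eQ_qInd ι₁ j c.Ψ hP hm i)
    (embOf_comp_jT ι₁ j)

/-- **the wedge of theta classes of types `Ψ₀, Ψ₁` is nonzero** (`Open_thetaWedge` for these theta sets), as soon
as the context admits `j` with `ι₁ ∘ j = σ`, `Ψ` is pair-sum and `σ` lies in all four types -/
theorem thetaSet_wedge₃ (V : HermSpace3 L ι₁) (c : SeesawCtx L) (j : c.K →+* L) (hj : ι₁.comp j = c.σ)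
    (hP : PairSum c.Ψ) (hmem : ∀ i, c.σ ∈ (c.Ψ i).1) :
    ∃ Γ : Level V, ∃ ω₁ ∈ thetaSet₃ d t ι₁ V c 0 Γ, ∃ ω₂ ∈ thetaSet₃ d t ι₁ V c 1 Γ,
      (toyUniverse₃ d t).cup2C ((toyUniverse₃ d t).pms L ι₁ V Γ) 1 ω₁ ω₂ ≠ 0 := by
  have hm : ∀ i, ι₁.comp j ∈ (c.Ψ i).1 := fun i => hj ▸ hmem i
  obtain ⟨Γ⟩ := Level.nonempty V
  exact ⟨Γ, _, ⟨j, hP, hm, hj, rfl⟩, _, ⟨j, hP, hm, hj, rfl⟩,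
    cup_eCls_ne_zero₃ d t ι₁ Γ (Or.inr (Or.inl Fin.zero_ne_one))⟩

/-- `Open_thetaSub` for ANY theta model on `toyUniverse₃ d t` whose theta sets are `thetaSet₃` -/
theorem open_thetaSub_of_theta_eq₃ (T : (toyUniverse₃ d t).ThetaModel)
    (hT : ∀ {L : CMField} {ι₁ : L →+* ℂ} (V : HermSpace3 L ι₁) (c : SeesawCtx L) (i : Fin 4) (Γ : Level V),
      T.Theta V c i Γ = thetaSet₃ d t ι₁ V c i Γ) :
    T.Open_thetaSub := by
  intro L ι₁ V c _ i Γ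
  rw [hT]
  exact thetaSet_sub_uiso₃ d t ι₁ V c i Γ

/-- `Open_thetaWedge` for ANY theta model on `toyUniverse₃ d t` whose theta sets are `thetaSet₃` -/
theorem open_thetaWedge_of_theta_eq₃ (T : (toyUniverse₃ d t).ThetaModel)
    (hT : ∀ {L : CMField} {ι₁ : L →+* ℂ} (V : HermSpace3 L ι₁) (c : SeesawCtx L) (i : Fin 4) (Γ : Level V),
      T.Theta V c i Γ = thetaSet₃ d t ι₁ V c i Γ) :
    T.Open_thetaWedge := by
  intro L ι₁ V c hc
  obtain ⟨j, hj, -⟩ := hc.forced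
  obtain ⟨Γ, ω₁, h₁, ω₂, h₂, hne⟩ := thetaSet_wedge₃ d t ι₁ V c j hj hc.pairSum hc.mem
  exact ⟨Γ, ω₁, (hT V c 0 Γ).symm ▸ h₁, ω₂, (hT V c 1 Γ).symm ▸ h₂, hne⟩

end U₃

end

end HodgeCM.ToyG2.ThetaUiso
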